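/-
Copyright (c) 2026. All rights reserved.
Released under Apache 2.0 license as described in the file LICENSE.
-/
import Literature.NumberTheory.Automorphic.EichlerOrderAtkinLehnerIdealTransport
import Literature.NumberTheory.Automorphic.EichlerOrdersAtkinLehnerGroup
import Literature.NumberTheory.Automorphic.BrandtMatrixRamifiedDivisors
import Literature.NumberTheory.Automorphic.DefiniteMaximalOrdersConjugacyClasses
import Literature.NumberTheory.Automorphic.BrandtSetupAdmissible
import HarnessLib

/-!
# The Atkin–Lehner ideal is conjugation-equivariant; `W_{p⁺}`-fixedness is a type invariant; the principal genus:
# `#Typ O = #Cls O` iff every left order represents the ramified primes and has principal Atkin–Lehner ideals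
# (Voight Lemma 18.5.1, Prop. 18.5.10, (23.4.20))

[tag: quaternion_algebra] [tag: eichler_order] [tag: class_number] [tag: hecke_operator]

Topic `NumberTheory/Automorphic`; THEOREMS ONLY (no definition, no named fact, no instance; net Literature debt `0`).
Lane `lit-hodgefound`, seat p12, gen 53 — sequel of `EichlerOrderAtkinLehnerIdealTransport.lean` (gen 53 #1:
`W_{p⁺} c = c ⟺ ∃ x ∈ 𝔔_{p^e}(O_L(I_c)), nrd x = p^e`).

THE PRINTED STATEMENTS (J. Voight, *Quaternion Algebras*, GTM 288). **Lemma 18.5.1** «`α ∈ N_{B^×}(O)` if and only if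
`αO = Oα` if and only if `OαO` is a principal two-sided `O`-ideal»; **Prop. 18.5.10** «The map `I ↦ [I]` induces a bijection
`PIdl(O) \ Idl(O) ↔ {[I] ∈ Cls O : O_L(I) ≃ O}`» — so the fibre of `Cls O → Typ O` over the type of `O′` is a point iff every
two-sided `O′`-ideal is principal; **(23.4.20)** «`0 → Idl(R) → Idl(O) → ∏_{𝔭 ∣ 𝔑} ℤ/2ℤ → 0`» for an Eichler order of reduced
discriminant `𝔑 = 𝔇𝔐`, the factors generated by the primes `𝔓_𝔮` (`𝔮 ∣ 𝔇`, 23.3.19) and the Atkin–Lehner ideals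
`𝔔_{𝔭^e} = Oϖ` (`𝔭^e ∥ 𝔐`, 23.4.14) (pp. 297–298, 375 of the book). **17.4.3**: conjugate orders `β O′ β⁻¹` have the same
arithmetic.

For a Brandt setup `S : XiSetup N⁺ N⁻` (a definite quaternion algebra `D` of discriminant `N⁻`, an Eichler order `O` of level
`N⁺`) the tree has: the involutions `W_{q⁻}` (`q ∣ N⁻`), `W_{p⁺}` (`p ∤ N⁻`) of `Cls O` with `W_{q⁻} c = c ⟺ ∃ x ∈ O_L(I_c),
nrd x = q` (`BrandtMatrixRamifiedDivisors.lean`), `W_{p⁺} c = c ⟺ ∃ x ∈ 𝔔_{p^e}(O_L(I_c)), nrd x = p^e`, `e = v_p(N⁺)`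
(`EichlerOrderAtkinLehnerIdealTransport.lean`), and `#Typ O = #Cls O ⟺` all `W` trivial (`EichlerOrdersAtkinLehnerGroup.lean`).
This file proves:

* §1 **`𝔔_m(β O β⁻¹) = β 𝔔_m(O) β⁻¹`** (`atkinLehnerIdeal_units_conj`: the trace form is conjugation invariant) and the
  conjugation invariance of the criteria «`∃ x ∈ O′, nrd x = r`», «`∃ x ∈ 𝔔_m(O′), nrd x = r`» (`SameType.…_iff`);
* §2 **`W_{q⁻}`- and `W_{p⁺}`-fixedness are type invariants** (`XiSetup.wMinus_eq_self_iff_of_typeOf_eq`,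
  `XiSetup.wPlus_eq_self_iff_of_typeOf_eq`): the Atkin–Lehner involutions fix all of a fibre of `Cls O → Typ O` or none of it;
* §3 the trivial class: **`W_{p⁺} [O] = [O] ⟺ 𝔔_{p^e}(O)` is principal `⟺ ∃ x ∈ 𝔔_{p^e}(O), nrd x = p^e`**, and then `O` has
  a normalising Atkin–Lehner element of reduced norm `p^e` (`XiSetup.wPlus_mk_self_eq_self_iff`, `…_iff_exists_units_smul`,
  `XiSetup.exists_atkinLehner_normaliser_of_wPlus_mk_self_eq_self`); the same for every class of the principal type;
* §4 **THE PRINCIPAL GENUS** (Voight Prop. 18.5.10 with (23.4.20)): **`#Typ O = #Cls O ⟺` for every class `c`, `O_L(I_c)`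
  contains an element of reduced norm `q` for every prime `q ∣ N⁻` AND an element of `𝔔_{p^{v_p N⁺}}(O_L(I_c))` of reduced
  norm `p^{v_p N⁺}` for every prime `p ∣ N⁺`** (`XiSetup.natCard_typeSet_eq_natCard_classSet_iff_forall_exists_reducedNorm`);
  in particular for class number one (`XiSetup.exists_mem_atkinLehnerIdeal_reducedNorm_eq_of_subsingleton`: `O` itself has
  Atkin–Lehner elements of every exact level norm `p^{v_p N⁺}` and elements of every ramified prime norm `q`).

## References

* [Voight2021] J. Voight, *Quaternion Algebras*, GTM 288 (2021): 17.4.3, Lemma 18.5.1, Prop. 18.5.3, Prop. 18.5.10, 23.4.14,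
  (23.4.20), (41.3.5).
* [VignerasLNM800] M.-F. Vignéras, *Arithmétique des algèbres de quaternions*, LNM 800 (1980), Ch. I §4 Cor. 4.11 (`t ≤ h`),
  Ch. III §5 exercice 5.8.
* [BertoliniDarmon1996] M. Bertolini, H. Darmon, *Heegner points on Mumford–Tate curves*, Invent. Math. 126 (1996), §1.5.

## Scope (honest)

Theorems only. The size of a fibre of `Cls O → Typ O` (`= [Idl(O′) : PIdl(O′)]`, Voight Prop. 18.5.10) is in
`EichlerOrdersAtkinLehnerGroup.lean` as an orbit of `(ℤ/2)^{ω(N⁺N⁻)}`; the identification of its stabiliser with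
`N(O′)/(ℚ^× O′^×)` (Voight Prop. 18.5.3) is not restated here.
-/

noncomputable section

open scoped Pointwise

universe u

namespace Literature.NumberTheory.Automorphic

/-! ## §1 Conjugation -/

section Conjugation

variable {B : Type u} [Ring B] [Algebra ℚ B]

/-- `trd(β⁻¹ z β) = trd z`. [cite: VignerasLNM800, Ch. I §1 Lemme 1.1] -/
private theorem reducedTrace_inv_conj [IsQuaternionAlgebra ℚ B] (β : Bˣ) (z : B) :
    reducedTrace ℚ B (((β⁻¹ : Bˣ) : B) * z * β) = reducedTrace ℚ B z := by
  have h := reducedTrace_units_conj ℚ B β⁻¹ z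
  rwa [inv_inv] at h

/-- `nrd(β⁻¹ z β) = nrd z`. [cite: VignerasLNM800, Ch. I §1 Lemme 1.1] -/
private theorem reducedNorm_inv_conj [IsQuaternionAlgebra ℚ B] (β : Bˣ) (z : B) :
    reducedNorm ℚ B (((β⁻¹ : Bˣ) : B) * z * β) = reducedNorm ℚ B z := by
  have h := reducedNorm_units_conj ℚ B β⁻¹ z
  rwa [inv_inv] at h

omit [Algebra ℚ B] in
/-- `β⁻¹ (β y β⁻¹) β = y`. [folklore] -/
private theorem inv_conj_conj (β : Bˣ) (y : B) :
    ((β⁻¹ : Bˣ) : B) * ((β : B) * y * ((β⁻¹ : Bˣ) : B)) * β = y := by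
  rw [← mul_assoc, ← mul_assoc, Units.inv_mul, one_mul, mul_assoc, Units.inv_mul, mul_one]

omit [Algebra ℚ B] in
/-- `β (β⁻¹ x β) β⁻¹ = x`. [folklore] -/
private theorem conj_inv_conj (β : Bˣ) (x : B) :
    (β : B) * (((β⁻¹ : Bˣ) : B) * x * β) * ((β⁻¹ : Bˣ) : B) = x := by
  rw [← mul_assoc, ← mul_assoc, Units.mul_inv, one_mul, mul_assoc, Units.mul_inv, mul_one]

/-- **The Atkin–Lehner ideal is conjugation-equivariant: `𝔔_m(β O β⁻¹) = β 𝔔_m(O) β⁻¹`** — the trace form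
`(x, y) ↦ trd(x y)` is invariant under `x ↦ β x β⁻¹` (conjugate orders are isomorphic, Voight 17.4.3). [cite: Voight2021, 17.4.3 and 23.4.14] [cite: VignerasLNM800, Ch. I §4 Lemme 4.7] -/
theorem atkinLehnerIdeal_units_conj [IsQuaternionAlgebra ℚ B] (β : Bˣ) (O : Submodule ℤ B) (m : ℕ) :
    atkinLehnerIdeal (β • (MulOpposite.op ((β⁻¹ : Bˣ) : B) • O)) m =
      β • (MulOpposite.op ((β⁻¹ : Bˣ) : B) • atkinLehnerIdeal O m) := by
  ext x
  rw [mem_atkinLehnerIdeal_iff, Brandt.mem_units_conj_iff, Brandt.mem_units_conj_iff, mem_atkinLehnerIdeal_iff]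
  constructor
  · rintro ⟨hx, h⟩
    refine ⟨hx, fun y hy => ?_⟩
    obtain ⟨n, hn⟩ := h ((β : B) * y * ((β⁻¹ : Bˣ) : B)) (by rw [Brandt.mem_units_conj_iff, inv_conj_conj]; exact hy)
    refine ⟨n, ?_⟩
    rw [← hn, ← reducedTrace_inv_conj β (x * ((β : B) * y * ((β⁻¹ : Bˣ) : B)))]
    congr 1
    simp only [mul_assoc, Units.inv_mul, mul_one]
  · rintro ⟨hx, h⟩
    refine ⟨hx, fun y hy => ?_⟩
    rw [Brandt.mem_units_conj_iff] at hy
    obtain ⟨n, hn⟩ := h _ hy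
    refine ⟨n, ?_⟩
    rw [← hn, ← reducedTrace_inv_conj β (x * y)]
    congr 1
    simp only [mul_assoc, Units.mul_inv_cancel_left]

/-- **«`O′` contains an element of reduced norm `r`» is a conjugation invariant.** [cite: Voight2021, 17.4.1 and 17.4.3] -/
theorem Brandt.SameType.exists_mem_reducedNorm_eq_iff [IsQuaternionAlgebra ℚ B] {O' O'' : Submodule ℤ B}
    (h : Brandt.SameType O' O'') (r : ℚ) :
    (∃ x ∈ O', reducedNorm ℚ B x = r) ↔ ∃ x ∈ O'', reducedNorm ℚ B x = r := by
  obtain ⟨β, rfl⟩ := h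
  constructor
  · rintro ⟨x, hx, hr⟩
    refine ⟨(β : B) * x * ((β⁻¹ : Bˣ) : B), by rw [Brandt.mem_units_conj_iff, inv_conj_conj]; exact hx, ?_⟩
    rw [reducedNorm_units_conj ℚ B, hr]
  · rintro ⟨x, hx, hr⟩
    rw [Brandt.mem_units_conj_iff] at hx
    exact ⟨_, hx, by rw [reducedNorm_inv_conj, hr]⟩

/-- **«`𝔔_m(O′)` contains an element of reduced norm `r`» is a conjugation invariant** (`𝔔_m(β O′ β⁻¹) = β 𝔔_m(O′) β⁻¹`).
[cite: Voight2021, 17.4.3 and Lemma 18.5.1] -/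
theorem Brandt.SameType.exists_mem_atkinLehnerIdeal_reducedNorm_eq_iff [IsQuaternionAlgebra ℚ B] {O' O'' : Submodule ℤ B}
    (h : Brandt.SameType O' O'') (m : ℕ) (r : ℚ) :
    (∃ x ∈ atkinLehnerIdeal O' m, reducedNorm ℚ B x = r) ↔ ∃ x ∈ atkinLehnerIdeal O'' m, reducedNorm ℚ B x = r := by
  obtain ⟨β, rfl⟩ := h
  rw [atkinLehnerIdeal_units_conj]
  exact Brandt.SameType.exists_mem_reducedNorm_eq_iff ⟨β, rfl⟩ r

/-- **Principality of `𝔔_m` is a conjugation invariant**: `𝔔_m(O′) = x O′ ⟹ 𝔔_m(β O′ β⁻¹) = (β x β⁻¹)(β O′ β⁻¹)`.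
[cite: Voight2021, 17.4.3 and Lemma 18.5.1] -/
theorem Brandt.SameType.exists_atkinLehnerIdeal_eq_units_smul [IsQuaternionAlgebra ℚ B] {O' O'' : Submodule ℤ B}
    (h : Brandt.SameType O' O'') (m : ℕ) (hx : ∃ x : Bˣ, atkinLehnerIdeal O' m = x • O') :
    ∃ x : Bˣ, atkinLehnerIdeal O'' m = x • O'' := by
  obtain ⟨β, rfl⟩ := h
  obtain ⟨x, hx⟩ := hx
  refine ⟨β * x * β⁻¹, ?_⟩
  rw [atkinLehnerIdeal_units_conj, hx]
  ext y
  rw [Brandt.mem_units_conj_iff, mem_units_smul_submodule_iff, mem_units_smul_submodule_iff, Brandt.mem_units_conj_iff,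
    Units.smul_def, Units.smul_def, smul_eq_mul, smul_eq_mul, mul_inv_rev, mul_inv_rev, inv_inv, Units.val_mul, Units.val_mul]
  constructor <;> intro hy
  · simpa only [mul_assoc, Units.inv_mul_cancel_left] using hy
  · simpa only [mul_assoc, Units.inv_mul_cancel_left] using hy

end Conjugation

namespace Brandt

variable {Nplus Nminus : ℕ} (S : XiSetup Nplus Nminus)

/-- The algebra of a setup is a division algebra. [folklore] -/
private theorem XiSetup.hdiv₅₄ : ∀ x : S.D, x ≠ 0 → IsUnit x :=
  fun _ hx => isUnit_of_isTotallyDefinite S.D S.isTotallyDefinite hx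

/-! ## §2 Fixedness under the Atkin–Lehner involutions is a type invariant -/

/-- **`W_{q⁻}`-fixedness is a type invariant**: if `O_L(I_c) ≃ O_L(I_{c'})` then `W_{q⁻} c = c ⟺ W_{q⁻} c' = c'` (both mean:
the left order contains an element of reduced norm `q`). [cite: Voight2021, Prop. 18.5.10 and (30.9.3)] -/
theorem XiSetup.wMinus_eq_self_iff_of_typeOf_eq {q : ℕ} [Fact q.Prime] (hq : q ∣ Nminus) {c c' : ClassSet S.O}
    (h : typeOf S.O c = typeOf S.O c') : S.wMinus q hq c = c ↔ S.wMinus q hq c' = c' := by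
  rw [S.wMinus_eq_self_iff hq c, S.wMinus_eq_self_iff hq c']
  exact (typeOf_eq_typeOf_iff.mp h).exists_mem_reducedNorm_eq_iff (q : ℚ)

/-- **`W_{p⁺}`-fixedness is a type invariant**: if `O_L(I_c) ≃ O_L(I_{c'})` then `W_{p⁺} c = c ⟺ W_{p⁺} c' = c'` (both mean:
the Atkin–Lehner ideal `𝔔_{p^e}` of the left order is principal). [cite: Voight2021, Prop. 18.5.10 and Lemma 18.5.1] -/
theorem XiSetup.wPlus_eq_self_iff_of_typeOf_eq {p : ℕ} [Fact p.Prime] (hp : ¬ p ∣ Nminus) {c c' : ClassSet S.O}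
    (h : typeOf S.O c = typeOf S.O c') : S.wPlus p hp c = c ↔ S.wPlus p hp c' = c' := by
  rw [S.wPlus_eq_self_iff hp c, S.wPlus_eq_self_iff hp c']
  exact (typeOf_eq_typeOf_iff.mp h).exists_mem_atkinLehnerIdeal_reducedNorm_eq_iff _ _

/-- Every class of the same type as a `W_{p⁺}`-fixed class is `W_{p⁺}`-fixed: an Atkin–Lehner involution fixes all of a fibre
of `Cls O → Typ O` or none of it. [cite: Voight2021, Prop. 18.5.10] -/
theorem XiSetup.wPlus_eq_self_of_typeOf_eq {p : ℕ} [Fact p.Prime] (hp : ¬ p ∣ Nminus) {c c' : ClassSet S.O}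
    (h : typeOf S.O c = typeOf S.O c') (hc : S.wPlus p hp c = c) : S.wPlus p hp c' = c' :=
  (S.wPlus_eq_self_iff_of_typeOf_eq hp h).mp hc

/-! ## §3 The trivial class and the principal type -/

/-- `O_L(O) = O` for the trivial right ideal of a setup. [cite: Voight2021, 17.3.6] -/
private theorem XiSetup.leftOrder_self : leftOrder S.O = S.O :=
  S.isEichlerOrder.isOrder.leftOrder_eq

/-- **`W_{p⁺} [O] = [O] ⟺ 𝔔_{p^e}(O)` is principal** (`e = v_p(N⁺)`). [cite: Voight2021, Prop. 18.5.10 and 23.4.14] -/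
theorem XiSetup.wPlus_mk_self_eq_self_iff_exists_units_smul {p : ℕ} [Fact p.Prime] (hp : ¬ p ∣ Nminus) :
    S.wPlus p hp (Quotient.mk (rightClassSetoid S.O) ⟨S.O, S.self_mem_rightIdeals⟩) =
        Quotient.mk (rightClassSetoid S.O) ⟨S.O, S.self_mem_rightIdeals⟩ ↔
      ∃ x : S.Dˣ, atkinLehnerIdeal S.O (p ^ Nplus.factorization p) = x • S.O := by
  have h := S.wPlus_mk_eq_self_iff hp ⟨S.O, S.self_mem_rightIdeals⟩
  rwa [show leftOrder (((⟨S.O, S.self_mem_rightIdeals⟩ : rightIdeals S.O)) : Submodule ℤ S.D) = S.O from S.leftOrder_self] at h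

/-- **`W_{p⁺} [O] = [O] ⟺ ∃ x ∈ 𝔔_{p^e}(O), nrd x = p^e`.** [cite: Voight2021, Prop. 18.5.10, Lemma 18.5.1 and 23.4.14] -/
theorem XiSetup.wPlus_mk_self_eq_self_iff {p : ℕ} [Fact p.Prime] (hp : ¬ p ∣ Nminus) :
    S.wPlus p hp (Quotient.mk (rightClassSetoid S.O) ⟨S.O, S.self_mem_rightIdeals⟩) =
        Quotient.mk (rightClassSetoid S.O) ⟨S.O, S.self_mem_rightIdeals⟩ ↔
      ∃ x ∈ atkinLehnerIdeal S.O (p ^ Nplus.factorization p), reducedNorm ℚ S.D x = (p : ℚ) ^ Nplus.factorization p := by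
  have h := (S.wPlus_mk_eq_self_iff hp ⟨S.O, S.self_mem_rightIdeals⟩).trans
    (S.exists_atkinLehnerIdeal_leftOrder_eq_units_smul_iff hp S.self_mem_rightIdeals)
  rwa [show leftOrder (((⟨S.O, S.self_mem_rightIdeals⟩ : rightIdeals S.O)) : Submodule ℤ S.D) = S.O from S.leftOrder_self] at h

/-- **A class of the principal type is `W_{p⁺}`-fixed iff `O` itself contains an Atkin–Lehner element of reduced norm `p^e` in
`𝔔_{p^e}(O)`.** [cite: Voight2021, Prop. 18.5.10 and Lemma 18.5.1] -/
theorem XiSetup.wPlus_eq_self_iff_of_sameType_self {p : ℕ} [Fact p.Prime] (hp : ¬ p ∣ Nminus) {c : ClassSet S.O}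
    (hc : SameType S.O (leftOrder c.rep)) :
    S.wPlus p hp c = c ↔
      ∃ x ∈ atkinLehnerIdeal S.O (p ^ Nplus.factorization p), reducedNorm ℚ S.D x = (p : ℚ) ^ Nplus.factorization p := by
  rw [S.wPlus_eq_self_iff hp c]
  exact (hc.exists_mem_atkinLehnerIdeal_reducedNorm_eq_iff _ _).symm

/-- **If `W_{p⁺}` fixes the trivial class then `O` has a normalising Atkin–Lehner element**: some `x ∈ 𝔔_{p^e}(O) ∩ N(O)` with
`nrd x = p^e` and `𝔔_{p^e}(O) = x O` (Voight Lemma 18.5.1: `N(O) ↠ PIdl(O)`; 23.4.14: `I = ϖO = Oϖ`). [cite: Voight2021, Lemma 18.5.1 and Prop. 23.4.14] -/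
theorem XiSetup.exists_atkinLehner_normaliser_of_wPlus_mk_self_eq_self {p : ℕ} [Fact p.Prime] (hp : ¬ p ∣ Nminus)
    (h : S.wPlus p hp (Quotient.mk (rightClassSetoid S.O) ⟨S.O, S.self_mem_rightIdeals⟩) =
      Quotient.mk (rightClassSetoid S.O) ⟨S.O, S.self_mem_rightIdeals⟩) :
    ∃ x : S.Dˣ, (x : S.D) ∈ atkinLehnerIdeal S.O (p ^ Nplus.factorization p) ∧
      reducedNorm ℚ S.D (x : S.D) = (p : ℚ) ^ Nplus.factorization p ∧
        atkinLehnerIdeal S.O (p ^ Nplus.factorization p) = x • S.O ∧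
          x • (MulOpposite.op ((x⁻¹ : S.Dˣ) : S.D) • S.O) = S.O := by
  obtain ⟨x, hx⟩ := (S.wPlus_mk_self_eq_self_iff_exists_units_smul hp).mp h
  obtain ⟨Φ, hΦ⟩ := S.exists_isLevelShape_iff S.nplus_ne_zero hp
  obtain ⟨n, hn, hne⟩ := natAbs_reducedNorm_eq_of_atkinLehnerIdeal_eq_units_smul Φ S.isZOrder_O hΦ S.hdiv₅₄ hx
  have hpos : 0 < n := by
    have h0 : 0 < reducedNorm ℚ S.D (x : S.D) :=
      lt_of_le_of_ne (reducedNorm_nonneg_of_isTotallyDefinite S.D S.isTotallyDefinite _)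
        ((isUnit_iff_reducedNorm_ne_zero_holds ℚ S.D (x : S.D)).mp x.isUnit).symm
    rw [hn] at h0
    exact_mod_cast h0
  refine ⟨x, ?_, ?_, hx, units_conj_eq_of_atkinLehnerIdeal_eq_units_smul Φ S.isZOrder_O hΦ S.hdiv₅₄ hx⟩
  · rw [hx]
    have h1 := Submodule.smul_mem_pointwise_smul (1 : S.D) x S.O S.isZOrder_O.one_mem
    rwa [Units.smul_def, smul_eq_mul, mul_one] at h1
  · rw [hn, ← Int.natAbs_of_nonneg hpos.le, hne]
    push_cast
    rfl

/-! ## §4 The principal genus: `#Typ O = #Cls O` -/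

include S in
/-- A prime factor of `N⁺` does not divide `N⁻`. [cite: VignerasLNM800, Ch. III §5 (niveau premier au discriminant)] -/
private theorem XiSetup.not_dvd_of_dvd_nplus {p : ℕ} (hp : p.Prime) (hpN : p ∣ Nplus) : ¬ p ∣ Nminus := fun h =>
  hp.one_lt.ne' (Nat.eq_one_of_dvd_coprimes S.coprime hpN h)

/-- **THE PRINCIPAL GENUS.** For a Brandt setup of type `(N⁺, N⁻)`: **`#Typ O = #Cls O`** (every Eichler order of level `N⁺`
locally isomorphic to `O` that is "stably" in the class of … — equivalently, the type map `Cls O → Typ O` is a bijection) **iff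
for every class `c`: `O_L(I_c)` contains an element of reduced norm `q` for every prime `q ∣ N⁻`, and `𝔔_{p^{v_p N⁺}}(O_L(I_c))`
contains an element of reduced norm `p^{v_p N⁺}` for every prime `p ∣ N⁺`** — i.e. iff all the two-sided ideals `𝔓_q`, `𝔔_{p^e}`
of all the left orders are principal (Voight Prop. 18.5.10: the fibre over the type of `O′` is `PIdl(O′) \ Idl(O′)`; (23.4.20):
`Idl(O′)/Idl(ℤ)` is generated by the `𝔓_q` and the `𝔔_{p^e}`). [cite: Voight2021, Prop. 18.5.10, Lemma 18.5.1 and (23.4.20)] [cite: VignerasLNM800, Ch. I §4 Cor. 4.11] -/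
theorem XiSetup.natCard_typeSet_eq_natCard_classSet_iff_forall_exists_reducedNorm :
    Nat.card (TypeSet S.O) = Nat.card (ClassSet S.O) ↔
      (∀ q : ℕ, q.Prime → q ∣ Nminus → ∀ c : ClassSet S.O, ∃ x ∈ leftOrder c.rep, reducedNorm ℚ S.D x = q) ∧
        ∀ p : ℕ, p.Prime → p ∣ Nplus → ∀ c : ClassSet S.O,
          ∃ x ∈ atkinLehnerIdeal (leftOrder c.rep) (p ^ Nplus.factorization p),
            reducedNorm ℚ S.D x = (p : ℚ) ^ Nplus.factorization p := by
  rw [S.natCard_typeSet_eq_natCard_classSet_iff_forall_atkinLehner]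
  constructor
  · rintro ⟨hminus, hplus⟩
    refine ⟨fun q hq hqN c => ?_, fun p hp hpN c => ?_⟩
    · haveI : Fact q.Prime := ⟨hq⟩
      exact (S.wMinus_eq_self_iff hqN c).mp (hminus q ⟨hq⟩ hqN c)
    · haveI : Fact p.Prime := ⟨hp⟩
      exact (S.wPlus_eq_self_iff (S.not_dvd_of_dvd_nplus hp hpN) c).mp (hplus p ⟨hp⟩ _ c)
  · rintro ⟨hminus, hplus⟩
    refine ⟨fun q hq hqN c => ?_, fun p hp hpN c => ?_⟩
    · exact (S.wMinus_eq_self_iff hqN c).mpr (hminus q hq.out hqN c)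
    · by_cases hpP : p ∣ Nplus
      · exact (S.wPlus_eq_self_iff hpN c).mpr (hplus p hp.out hpP c)
      · exact S.wPlus_eq_self_of_not_dvd hpN hpP c

/-- **In the principal genus every left order has Atkin–Lehner elements of every exact level norm**: if `#Typ O = #Cls O` then
for every class `c` and every prime `p ∤ N⁻` there is `x ∈ 𝔔_{p^{v_p N⁺}}(O_L(I_c))` with `nrd x = p^{v_p N⁺}`. [cite: Voight2021, Prop. 18.5.10 and (23.4.20)] -/
theorem XiSetup.exists_mem_atkinLehnerIdeal_reducedNorm_eq_of_natCard_eq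
    (h : Nat.card (TypeSet S.O) = Nat.card (ClassSet S.O)) {p : ℕ} [Fact p.Prime] (hp : ¬ p ∣ Nminus) (c : ClassSet S.O) :
    ∃ x ∈ atkinLehnerIdeal (leftOrder c.rep) (p ^ Nplus.factorization p),
      reducedNorm ℚ S.D x = (p : ℚ) ^ Nplus.factorization p :=
  (S.wPlus_eq_self_iff hp c).mp ((S.natCard_typeSet_eq_natCard_classSet_iff_forall_atkinLehner.mp h).2 p inferInstance hp c)

/-- **Class number one: `O` has an Atkin–Lehner element of reduced norm `p^{v_p N⁺}` in `𝔔_{p^{v_p N⁺}}(O)` for every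
`p ∤ N⁻`** (all classes, in particular `[O]`, are `W_{p⁺}`-fixed) — e.g. at the class-number-one levels of Voight's
Table 25.4.4 ∕ Kirschmer–Voight. [cite: Voight2021, Prop. 18.5.10, 23.4.14 and §25.4] -/
theorem XiSetup.exists_mem_atkinLehnerIdeal_reducedNorm_eq_of_subsingleton [Subsingleton (ClassSet S.O)] {p : ℕ}
    [Fact p.Prime] (hp : ¬ p ∣ Nminus) :
    ∃ x ∈ atkinLehnerIdeal S.O (p ^ Nplus.factorization p), reducedNorm ℚ S.D x = (p : ℚ) ^ Nplus.factorization p :=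
  (S.wPlus_mk_self_eq_self_iff hp).mp (Subsingleton.elim _ _)

/-- **Class number one: `𝔔_{p^{v_p N⁺}}(O)` is principal, generated by a normalising element of reduced norm `p^{v_p N⁺}`**
(`p ∤ N⁻`). [cite: Voight2021, Lemma 18.5.1, Prop. 23.4.14 and §25.4] -/
theorem XiSetup.exists_atkinLehner_normaliser_of_subsingleton [Subsingleton (ClassSet S.O)] {p : ℕ} [Fact p.Prime]
    (hp : ¬ p ∣ Nminus) :
    ∃ x : S.Dˣ, (x : S.D) ∈ atkinLehnerIdeal S.O (p ^ Nplus.factorization p) ∧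
      reducedNorm ℚ S.D (x : S.D) = (p : ℚ) ^ Nplus.factorization p ∧
        atkinLehnerIdeal S.O (p ^ Nplus.factorization p) = x • S.O ∧
          x • (MulOpposite.op ((x⁻¹ : S.Dˣ) : S.D) • S.O) = S.O :=
  S.exists_atkinLehner_normaliser_of_wPlus_mk_self_eq_self hp (Subsingleton.elim _ _)

/-- **Class number one: `O` contains an element of reduced norm `q` for every prime `q ∣ N⁻`** (the ramified primes `𝔓_q` of
`O` are principal). [cite: Voight2021, Prop. 18.5.10, 23.3.19 and §25.4] -/
theorem XiSetup.exists_mem_reducedNorm_eq_of_subsingleton_of_dvd [Subsingleton (ClassSet S.O)] {q : ℕ} [Fact q.Prime]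
    (hq : q ∣ Nminus) : ∃ x ∈ S.O, reducedNorm ℚ S.D x = q := by
  have h := (S.wMinus_eq_self_iff hq (Quotient.mk (rightClassSetoid S.O) ⟨S.O, S.self_mem_rightIdeals⟩)).mp
    (Subsingleton.elim _ _)
  exact ((S.sameType_leftOrder_rep_mk_self).exists_mem_reducedNorm_eq_iff (q : ℚ)).mpr h

/-- **`#Typ O = #Cls O` implies that `O` itself represents every ramified prime and has principal Atkin–Lehner ideals.**
[cite: Voight2021, Prop. 18.5.10 and (23.4.20)] -/
theorem XiSetup.exists_mem_reducedNorm_eq_and_of_natCard_eq (h : Nat.card (TypeSet S.O) = Nat.card (ClassSet S.O)) :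
    (∀ q : ℕ, q.Prime → q ∣ Nminus → ∃ x ∈ S.O, reducedNorm ℚ S.D x = q) ∧
      ∀ p : ℕ, p.Prime → ¬ p ∣ Nminus →
        ∃ x ∈ atkinLehnerIdeal S.O (p ^ Nplus.factorization p), reducedNorm ℚ S.D x = (p : ℚ) ^ Nplus.factorization p := by
  obtain ⟨hminus, hplus⟩ := S.natCard_typeSet_eq_natCard_classSet_iff_forall_atkinLehner.mp h
  refine ⟨fun q hq hqN => ?_, fun p hp hpN => ?_⟩
  · haveI : Fact q.Prime := ⟨hq⟩
    have h1 := (S.wMinus_eq_self_iff hqN (Quotient.mk (rightClassSetoid S.O) ⟨S.O, S.self_mem_rightIdeals⟩)).mp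
      (hminus q ⟨hq⟩ hqN _)
    exact ((S.sameType_leftOrder_rep_mk_self).exists_mem_reducedNorm_eq_iff (q : ℚ)).mpr h1
  · haveI : Fact p.Prime := ⟨hp⟩
    exact (S.wPlus_mk_self_eq_self_iff hpN).mp (hplus p ⟨hp⟩ hpN _)

end Brandt

end Literature.NumberTheory.Automorphic

end
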